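import Summits.Ventures.DiscreteObjects.Hadamard.ParityLift167

/-!
# Symmetric designs modulo a prime `q ∥ n`: Gram identities and the lifting lemma (kernel, general parameters)

Framing: lottery ticket; floor = certified bounds/negative ranges.

Cell pub-namedobj (venture DiscreteObjects), target (H), hadamard gen 8.  General-parameter version of `ParityLift167` (which did
`(k, λ, q) = (333, 166, 167)`): for a `0/1` incidence function `N : P → B → ℤ` with column sums `k` and column inner products
`λ`, and a prime `q` with `q ∣ k - λ = n`, `q² ∤ n`, `q ∤ λ`:
* `gram_modq` — every entry of `N̄ᵀ N̄` is `λ̄` in `ZMod q`, so `N̄ᵀ(N̄ w) = λ̄ (Σ w)·𝟙` (`transpose_mulVec_mulVec_modq`);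
* `lift_modq` — **LIFTING LEMMA**: if `N̄ v = 0` over `ZMod q` then `v = N̄ᵀ w + s·𝟙` for some `w`, `s` (lift to `ℤ`:
  `N ṽ = q w̃`, `Nᵀ N ṽ = n ṽ + λ (Σ ṽ) 𝟙 = q Nᵀ w̃` forces `q ∣ Σ ṽ` and, with `n = q n₁`, `q ∤ n₁`,
  `n₁ ṽ ≡ Nᵀ w̃ - λ (Σ ṽ / q) 𝟙`).
Input of the kernel proof of Lander's parity theorem (Symmetric Designs, 1983, Thm 3.20(2)) in `LanderParity`.
Ours, not literature; no `sorry`.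
-/

open Finset BigOperators

namespace Summit.Ventures.DiscreteObjects.Hadamard

variable {P B : Type*} [Fintype P] [Fintype B] [DecidableEq B]

omit [Fintype B] in
/-- column Gram matrix over `ℤ`: `Σ_x N x y · N x y' = k` or `λ` -/
lemma gram_col_int' (N : P → B → ℤ) (h01 : ∀ x y, N x y = 0 ∨ N x y = 1) {k lam : ℤ} (hcol : ∀ y, ∑ x, N x y = k)
    (hcpair : ∀ y y', y ≠ y' → ∑ x, N x y * N x y' = lam) (y y' : B) :
    ∑ x, N x y * N x y' = if y = y' then k else lam := by
  split_ifs with h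
  · subst h
    rw [Finset.sum_congr rfl fun x _ => mul_self_of_zero_or_one (h01 x y)]
    exact hcol y
  · exact hcpair y y' h

omit [Fintype B] in
/-- **Gram modulo `q`**: every entry of `N̄ᵀ N̄` is `λ̄` in `ZMod q` when `q ∣ k - λ` -/
theorem gram_modq (N : P → B → ℤ) (h01 : ∀ x y, N x y = 0 ∨ N x y = 1) {k lam : ℤ} (hcol : ∀ y, ∑ x, N x y = k)
    (hcpair : ∀ y y', y ≠ y' → ∑ x, N x y * N x y' = lam) {q : ℕ} (hqn : (q : ℤ) ∣ k - lam) (y y' : B) :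
    ∑ x, (N x y : ZMod q) * (N x y' : ZMod q) = (lam : ZMod q) := by
  have e := congrArg (Int.cast : ℤ → ZMod q) (gram_col_int' N h01 hcol hcpair y y')
  push_cast at e
  rw [e]
  split_ifs
  · have : ((k - lam : ℤ) : ZMod q) = 0 := (ZMod.intCast_zmod_eq_zero_iff_dvd _ q).mpr hqn
    rw [Int.cast_sub, sub_eq_zero] at this
    exact this
  · rfl

/-- `N̄ᵀ (N̄ w) = λ̄ (Σ w) · 𝟙` over `ZMod q` -/
theorem transpose_mulVec_mulVec_modq (N : P → B → ℤ) (h01 : ∀ x y, N x y = 0 ∨ N x y = 1) {k lam : ℤ}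
    (hcol : ∀ y, ∑ x, N x y = k) (hcpair : ∀ y y', y ≠ y' → ∑ x, N x y * N x y' = lam) {q : ℕ}
    (hqn : (q : ℤ) ∣ k - lam) (w : B → ZMod q) (y : B) :
    ∑ x, (N x y : ZMod q) * ∑ y', (N x y' : ZMod q) * w y' = (lam : ZMod q) * ∑ y', w y' := by
  calc ∑ x, (N x y : ZMod q) * ∑ y', (N x y' : ZMod q) * w y'
      = ∑ y', (∑ x, (N x y : ZMod q) * (N x y' : ZMod q)) * w y' := by
        simp_rw [Finset.mul_sum, Finset.sum_mul, mul_assoc]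
        exact Finset.sum_comm
    _ = ∑ y', (lam : ZMod q) * w y' := Finset.sum_congr rfl fun y' _ => by rw [gram_modq N h01 hcol hcpair hqn]
    _ = (lam : ZMod q) * ∑ y', w y' := by rw [Finset.mul_sum]

/-- **Lifting lemma** (`q` prime, `q ∣ n = k - λ`, `q² ∤ n`, `q ∤ λ`): over `ZMod q`, `N̄ v = 0` implies `v = N̄ᵀ w + s · 𝟙`. -/
theorem lift_modq (N : P → B → ℤ) (h01 : ∀ x y, N x y = 0 ∨ N x y = 1) {k lam : ℤ} (hcol : ∀ y, ∑ x, N x y = k)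
    (hcpair : ∀ y y', y ≠ y' → ∑ x, N x y * N x y' = lam)
    {q : ℕ} [Fact (Nat.Prime q)] (hqn : (q : ℤ) ∣ k - lam) (hq2 : ¬ (q : ℤ) ^ 2 ∣ k - lam) (hql : ¬ (q : ℤ) ∣ lam)
    (v : B → ZMod q) (hv : ∀ x, ∑ y, (N x y : ZMod q) * v y = 0) :
    ∃ (w : P → ZMod q) (s : ZMod q), ∀ y, v y = (∑ x, (N x y : ZMod q) * w x) + s := by
  have hqP : Prime (q : ℤ) := Nat.prime_iff_prime_int.mp (Fact.out : q.Prime)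
  obtain ⟨n₁, hn₁⟩ := hqn
  have hqn₁ : ¬ (q : ℤ) ∣ n₁ := by
    rintro ⟨t, ht⟩
    exact hq2 ⟨t, by rw [hn₁, ht]; ring⟩
  -- integer lift of v
  let vz : B → ℤ := fun y => ((v y).val : ℤ)
  have hvz : ∀ y, ((vz y : ℤ) : ZMod q) = v y := fun y => by
    simp only [vz, Int.cast_natCast, ZMod.natCast_zmod_val]
  -- N vz ≡ 0 (mod q)
  have hdvd : ∀ x, (q : ℤ) ∣ ∑ y, N x y * vz y := by
    intro x
    have h0 : ((∑ y, N x y * vz y : ℤ) : ZMod q) = 0 := by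
      push_cast
      simp_rw [hvz]
      exact hv x
    exact (ZMod.intCast_zmod_eq_zero_iff_dvd _ q).mp h0
  choose wz hwz using hdvd
  set S : ℤ := ∑ y, vz y with hS
  -- Nᵀ N vz = n vz + λ S
  have key : ∀ y, (q : ℤ) * ∑ x, N x y * wz x = (k - lam) * vz y + lam * S := by
    intro y
    calc (q : ℤ) * ∑ x, N x y * wz x = ∑ x, N x y * ((q : ℤ) * wz x) := by
          rw [Finset.mul_sum]
          exact Finset.sum_congr rfl fun x _ => by ring
      _ = ∑ x, N x y * ∑ y', N x y' * vz y' := by simp_rw [← hwz]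
      _ = ∑ y', (∑ x, N x y * N x y') * vz y' := by
          simp_rw [Finset.mul_sum, Finset.sum_mul, mul_assoc]
          exact Finset.sum_comm
      _ = ∑ y', (lam * vz y' + if y = y' then (k - lam) * vz y' else 0) := by
          refine Finset.sum_congr rfl fun y' _ => ?_
          rw [gram_col_int' N h01 hcol hcpair y y']
          split_ifs <;> ring
      _ = (k - lam) * vz y + lam * S := by
          rw [Finset.sum_add_distrib, Finset.sum_ite_eq, if_pos (Finset.mem_univ y), ← Finset.mul_sum, hS]
          ring
  -- q ∣ S
  have hSdvd : (q : ℤ) ∣ S := by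
    rcases isEmpty_or_nonempty B with hB | ⟨⟨y₀⟩⟩
    · rw [hS, Finset.univ_eq_empty, Finset.sum_empty]
      exact dvd_zero _
    · have h1 : (q : ℤ) ∣ lam * S :=
        ⟨∑ x, N x y₀ * wz x - n₁ * vz y₀, by have := key y₀; rw [hn₁] at this; linarith⟩
      exact (hqP.dvd_or_dvd h1).resolve_left hql
  obtain ⟨sz, hsz⟩ := hSdvd
  -- n₁ vz y = Σ_x N x y wz x - λ sz
  have hsol : ∀ y, n₁ * vz y = ∑ x, N x y * wz x + (-(lam * sz)) := by
    intro y
    have e := key y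
    rw [hsz, hn₁] at e
    have hq0 : (q : ℤ) ≠ 0 := by exact_mod_cast (Fact.out : q.Prime).ne_zero
    have : (q : ℤ) * (n₁ * vz y) = (q : ℤ) * (∑ x, N x y * wz x + (-(lam * sz))) := by linarith
    exact mul_left_cancel₀ hq0 this
  -- invert n₁ modulo q
  have hn₁0 : ((n₁ : ℤ) : ZMod q) ≠ 0 := by
    intro h0
    exact hqn₁ ((ZMod.intCast_zmod_eq_zero_iff_dvd _ q).mp h0)
  refine ⟨fun x => ((n₁ : ℤ) : ZMod q)⁻¹ * (wz x : ZMod q), ((n₁ : ℤ) : ZMod q)⁻¹ * ((-(lam * sz) : ℤ) : ZMod q),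
    fun y => ?_⟩
  have e := congrArg (Int.cast : ℤ → ZMod q) (hsol y)
  push_cast at e
  rw [hvz] at e
  -- e : n₁ * v y = Σ + (-(lam * sz))
  have : v y = ((n₁ : ℤ) : ZMod q)⁻¹ * (((n₁ : ℤ) : ZMod q) * v y) := by
    rw [← mul_assoc, inv_mul_cancel₀ hn₁0, one_mul]
  rw [this, e, mul_add, Finset.mul_sum]
  congr 1
  · refine Finset.sum_congr rfl fun x _ => by ring
  · push_cast; ring

end Summit.Ventures.DiscreteObjects.Hadamard
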